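import Literature.MathematicalPhysics.QuantumLattice.HubbardTTPrimeEnergyDensityVariationalPrinciple
import Literature.MathematicalPhysics.QuantumLattice.InfVolFermionStateMixture
import Literature.MathematicalPhysics.QuantumLattice.HubbardNNNHoppingEnergyDensityConvex
import HarnessLib

/-!
# Phase coexistence at `T = 0` forces an affine piece of the energy–density curve: certified strict convexity of
# `n ↦ e(t,t',U,n)` EXCLUDES macroscopic phase separation (a «competing order» word from energy windows alone)

Topic `Literature/MathematicalPhysics/QuantumLattice`. `e(n) = energyDensityTT' t t' U n` is the ground-state energy density of
the 2D `t–t'` Hubbard model (convex on `[0,2)`, `convexOn_energyDensityTT'`; the least mean energy of a translation-invariant state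
of density `n ∈ (0,2)`, `IsTranslationInvariant.energyDensityTT'_le_meanEnergy`). A translation-invariant GROUND STATE `ω` of density
`n` (`e_Φ(ω) = e(n)`) describes MACROSCOPIC PHASE COEXISTENCE of densities `n₁ < n₂` if it is a non-trivial mixture
`ω = λ ω₁ + (1−λ) ω₂` (`InfVolFermionState.mix`) of translation-invariant states of densities `n₁, n₂` (Maxwell / Emery–Kivelson–Lin
phase separation: hole-rich and hole-poor regions). PROVED (`U ≥ 0`, `0 < n₁`, `n₂ < 2`, `0 < λ < 1`):

* §1 `IsTranslationInvariant.energyDensityTT'_eq_convexComb_of_mix_of_meanEnergy_eq` — coexistence forces the CHORD IDENTITY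
  `e(λn₁ + (1−λ)n₂) = λ e(n₁) + (1−λ) e(n₂)` and both components are themselves ground states (`…meanEnergy_eq_of_mix_left/right`);
* §2 `convexOn_affine_of_eq_convexComb` (real analysis) — a convex function touching a chord at ONE interior point coincides with the
  chord on the whole segment; hence (`energyDensityTT'_eq_chord_on_segment_of_mix`) coexistence of `n₁, n₂` makes `e` AFFINE on `[n₁, n₂]`;
* §3 EXCLUSION READINGS: `not_mix_of_energyDensityTT'_lt_convexComb` — if `e(n) < λe(n₁) + (1−λ)e(n₂)` (`n = λn₁ + (1−λ)n₂`) then NO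
  translation-invariant ground state of density `n` is such a mixture; certified form `not_mix_of_cap_lt_convexComb_floors` — a CAP
  `e(n) ≤ c` and FLOORS `f_i ≤ e(n_i)` with `c < λf₁ + (1−λ)f₂` exclude coexistence of the densities `n₁, n₂` at mean density `n`; and the
  SEGMENT form `not_mix_of_strict_at_interior_point` — one certified strict-convexity defect at `(n₁, n₀, n₂)` excludes coexistence of
  EVERY pair of densities `n₁' ≤ n₁ < n₂ ≤ n₂'` at EVERY mean density in between (the affine piece would contain `[n₁,n₂]`).
* §4 SUPER-SEGMENT form `…_of_strict_at_of_le` / `…_of_cap_lt_floors_of_le` — the same defect excludes coexistence of every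
  pair of translation-invariant states with densities `ρ(ω₁) ≤ n₁`, `ρ(ω₂) ≥ n₂` (real analysis `affine_subchord_of_eq_chord`); and the
  ENERGY GAP of a phase-separated state `convexComb_floors_le_meanEnergy_mix` / `energyDensityTT'_add_margin_le_meanEnergy_mix`.

HONEST SCOPE: statements about translation-invariant states and their two-component convex decompositions (the tree's ground-state
objects are translation invariant: torus limits / filling-class minimisers); «coexistence» of more components reduces to two by grouping;
no claim about domain walls, stripes of finite period (those are PERIODIC states with ONE density — not excluded here), or `T > 0`.
Everything is PROVED; no definition, no named fact.

## Mathlib / tree search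

REUSED: `InfVolFermionState.mix`, `density_mix`, `meanEnergy_mix`, `IsTranslationInvariant.mix` (`InfVolFermionState(Mixture)`);
`IsTranslationInvariant.energyDensityTT'_le_meanEnergy` (`HubbardTTPrimeEnergyDensityVariationalPrinciple`); `convexOn_energyDensityTT'`
(`HubbardNNNHoppingEnergyDensityConvex`); Mathlib `ConvexOn`. `lean search 'phase separ|coexist|affine.*energyDensityTT'`: nothing (2026-08-27).

## References

* V. J. Emery, S. A. Kivelson, H. Q. Lin, Phys. Rev. Lett. 64 (1990) 475 (phase separation in the t–J model; Maxwell construction on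
  `e(n)`). [cite: EmeryKivelsonLin1990, pp. 475–476]
* R. B. Israel, *Convexity in the Theory of Lattice Gases* (1979), §I.2, Thm. I.2.4 (flat pieces of thermodynamic functions = phase
  coexistence). [cite: Israel1979, Thm. I.2.4]
* D. Ruelle, *Statistical Mechanics: Rigorous Results* (1969), §3.4. [cite: Ruelle1969, §3.4]
-/

noncomputable section

open scoped ComplexOrder BigOperators
open Finset

namespace Literature.MathematicalPhysics.QuantumLattice

open Matrix HubbardWave0 Literature.Probability.LatticeModels ThermodynamicLimit

/-! ### §2 (real analysis first) A convex function touching a chord at an interior point is the chord on the segment -/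

/-- **Equality in Jensen at one interior point forces affinity on the segment.** Let `f` be convex on a convex set `s ∋ x, y`,
`0 < a`, `0 < b`, `a + b = 1`, and `f(a x + b y) = a f x + b f y`. Then for all `p, q ≥ 0` with `p + q = 1`:
`f(p x + q y) = p f x + q f y`. [cite: Israel1979, Thm. I.2.4] -/
theorem convexOn_affine_of_eq_convexComb {s : Set ℝ} {f : ℝ → ℝ} (hf : ConvexOn ℝ s f) {x y : ℝ} (hx : x ∈ s) (hy : y ∈ s)
    {a b : ℝ} (ha : 0 < a) (hb : 0 < b) (hab : a + b = 1) (heq : f (a * x + b * y) = a * f x + b * f y)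
    {p q : ℝ} (hp : 0 ≤ p) (hq : 0 ≤ q) (hpq : p + q = 1) :
    f (p * x + q * y) = p * f x + q * f y := by
  -- Jensen gives `≤`; for `≥`, the touching point is a convex combination of `z = p x + q y` and an endpoint
  have hle : f (p * x + q * y) ≤ p * f x + q * f y := by
    have := hf.2 hx hy hp hq hpq
    simpa [smul_eq_mul] using this
  refine le_antisymm hle ?_
  set z := p * x + q * y with hz
  have hzmem : z ∈ s := by
    have := hf.1 hx hy hp hq hpq
    simpa [smul_eq_mul, hz] using this
  by_contra hlt
  have hlt' : f z < p * f x + q * f y := lt_of_not_ge hlt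
  rcases le_or_gt a p with hap | hap
  · -- `a ≤ p`: `a x + b y = θ z + (1 − θ) y` with `θ = a/p`
    have hp0 : 0 < p := lt_of_lt_of_le ha hap
    set θ : ℝ := a / p with hθ
    have hθ0 : 0 < θ := div_pos ha hp0
    have hθ1 : θ ≤ 1 := by rw [hθ, div_le_one hp0]; exact hap
    have hθp : θ * p = a := by rw [hθ]; field_simp
    have hθq : θ * q + (1 - θ) = b := by
      have hq' : q = 1 - p := by linarith
      have hb' : b = 1 - a := by linarith
      rw [hq', hb', ← hθp]; ring
    have hcomb : a * x + b * y = θ * z + (1 - θ) * y := by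
      rw [hz, ← hθp, ← hθq]; ring
    have hJ : f (θ * z + (1 - θ) * y) ≤ θ * f z + (1 - θ) * f y := by
      have := hf.2 hzmem hy hθ0.le (by linarith) (by ring : θ + (1 - θ) = 1)
      simpa [smul_eq_mul] using this
    rw [← hcomb, heq] at hJ
    have key : θ * (p * f x + q * f y) + (1 - θ) * f y = a * f x + b * f y := by
      linear_combination (f x) * hθp + (f y) * hθq
    have hstrict : θ * f z < θ * (p * f x + q * f y) := mul_lt_mul_of_pos_left hlt' hθ0
    linarith
  · -- `p < a`, so `b < q`: `a x + b y = θ z + (1 − θ) x` with `θ = b/q`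
    have hbq : b < q := by linarith
    have hq0 : 0 < q := lt_trans hb hbq
    set θ : ℝ := b / q with hθ
    have hθ0 : 0 < θ := div_pos hb hq0
    have hθ1 : θ ≤ 1 := by rw [hθ, div_le_one hq0]; exact hbq.le
    have hθq : θ * q = b := by rw [hθ]; field_simp
    have hθp : θ * p + (1 - θ) = a := by
      have hp' : p = 1 - q := by linarith
      have ha' : a = 1 - b := by linarith
      rw [hp', ha', ← hθq]; ring
    have hcomb : a * x + b * y = θ * z + (1 - θ) * x := by
      rw [hz, ← hθp, ← hθq]; ring
    have hJ : f (θ * z + (1 - θ) * x) ≤ θ * f z + (1 - θ) * f x := by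
      have := hf.2 hzmem hx hθ0.le (by linarith) (by ring : θ + (1 - θ) = 1)
      simpa [smul_eq_mul] using this
    rw [← hcomb, heq] at hJ
    have key : θ * (p * f x + q * f y) + (1 - θ) * f x = a * f x + b * f y := by
      linear_combination (f x) * hθp + (f y) * hθq
    have hstrict : θ * f z < θ * (p * f x + q * f y) := mul_lt_mul_of_pos_left hlt' hθ0
    linarith

namespace InfVolFermionState

variable {U : ℝ}

/-! ### §1 Coexistence forces the chord identity -/

/-- **Phase coexistence at `T = 0` forces the chord identity.** Let `ω₁, ω₂` be translation-invariant states of densities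
`n₁ = ρ(ω₁)`, `n₂ = ρ(ω₂)` in `(0,2)`, `0 ≤ λ ≤ 1`, and suppose the mixture `ω = λω₁ + (1−λ)ω₂` is a GROUND STATE:
`e_Φ(ω) ≤ e(ρ(ω))` (hence `=`). Then `e(λn₁ + (1−λ)n₂) = λ e(n₁) + (1−λ) e(n₂)`. [cite: Israel1979, Thm. I.2.4]
[cite: EmeryKivelsonLin1990, pp. 475–476] -/
theorem IsTranslationInvariant.energyDensityTT'_eq_convexComb_of_mix_of_meanEnergy_le (t t' : ℝ) (hU : 0 ≤ U)
    {ω₁ ω₂ : InfVolFermionState 2} (h₁ : ω₁.IsTranslationInvariant) (h₂ : ω₂.IsTranslationInvariant)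
    (hρ₁ : 0 < ω₁.density) (hρ₁' : ω₁.density < 2) (hρ₂ : 0 < ω₂.density) (hρ₂' : ω₂.density < 2)
    {lam : ℝ} (hl0 : 0 ≤ lam) (hl1 : lam ≤ 1)
    (hGS : (InfVolFermionState.mix lam hl0 hl1 ω₁ ω₂).meanEnergy (hubbardTTPrimeFermionInteraction t t' U) 1 ≤
      energyDensityTT' t t' U (InfVolFermionState.mix lam hl0 hl1 ω₁ ω₂).density) :
    energyDensityTT' t t' U (lam * ω₁.density + (1 - lam) * ω₂.density) =
      lam * energyDensityTT' t t' U ω₁.density + (1 - lam) * energyDensityTT' t t' U ω₂.density := by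
  have hv₁ := h₁.energyDensityTT'_le_meanEnergy t t' hU hρ₁ hρ₁'
  have hv₂ := h₂.energyDensityTT'_le_meanEnergy t t' hU hρ₂ hρ₂'
  have hconv := (convexOn_energyDensityTT' t t' hU).2 (x := ω₁.density) (y := ω₂.density) ⟨hρ₁.le, hρ₁'⟩ ⟨hρ₂.le, hρ₂'⟩
    hl0 (by linarith : 0 ≤ 1 - lam) (by ring)
  simp only [smul_eq_mul] at hconv
  rw [density_mix, meanEnergy_mix] at hGS
  refine le_antisymm hconv ?_
  have h1 := mul_le_mul_of_nonneg_left hv₁ hl0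
  have h2 := mul_le_mul_of_nonneg_left hv₂ (by linarith : 0 ≤ 1 - lam)
  linarith

/-- **… and the first component is a ground state** (`0 < λ`): `e_Φ(ω₁) = e(n₁)`. [cite: Israel1979, Thm. I.2.4] -/
theorem IsTranslationInvariant.meanEnergy_eq_of_mix_left (t t' : ℝ) (hU : 0 ≤ U)
    {ω₁ ω₂ : InfVolFermionState 2} (h₁ : ω₁.IsTranslationInvariant) (h₂ : ω₂.IsTranslationInvariant)
    (hρ₁ : 0 < ω₁.density) (hρ₁' : ω₁.density < 2) (hρ₂ : 0 < ω₂.density) (hρ₂' : ω₂.density < 2)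
    {lam : ℝ} (hl0 : 0 < lam) (hl1 : lam ≤ 1)
    (hGS : (InfVolFermionState.mix lam hl0.le hl1 ω₁ ω₂).meanEnergy (hubbardTTPrimeFermionInteraction t t' U) 1 ≤
      energyDensityTT' t t' U (InfVolFermionState.mix lam hl0.le hl1 ω₁ ω₂).density) :
    ω₁.meanEnergy (hubbardTTPrimeFermionInteraction t t' U) 1 = energyDensityTT' t t' U ω₁.density := by
  have hv₁ := h₁.energyDensityTT'_le_meanEnergy t t' hU hρ₁ hρ₁'
  have hv₂ := h₂.energyDensityTT'_le_meanEnergy t t' hU hρ₂ hρ₂'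
  have hconv := (convexOn_energyDensityTT' t t' hU).2 (x := ω₁.density) (y := ω₂.density) ⟨hρ₁.le, hρ₁'⟩ ⟨hρ₂.le, hρ₂'⟩
    hl0.le (by linarith : 0 ≤ 1 - lam) (by ring)
  simp only [smul_eq_mul] at hconv
  rw [density_mix, meanEnergy_mix] at hGS
  refine le_antisymm ?_ hv₁
  have h2 := mul_le_mul_of_nonneg_left hv₂ (by linarith : 0 ≤ 1 - lam)
  by_contra hlt
  have hlt' := lt_of_not_ge hlt
  have h1 : lam * energyDensityTT' t t' U ω₁.density < lam * ω₁.meanEnergy (hubbardTTPrimeFermionInteraction t t' U) 1 :=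
    mul_lt_mul_of_pos_left hlt' hl0
  linarith

/-- **… and the second component is a ground state** (`λ < 1`): `e_Φ(ω₂) = e(n₂)`. [cite: Israel1979, Thm. I.2.4] -/
theorem IsTranslationInvariant.meanEnergy_eq_of_mix_right (t t' : ℝ) (hU : 0 ≤ U)
    {ω₁ ω₂ : InfVolFermionState 2} (h₁ : ω₁.IsTranslationInvariant) (h₂ : ω₂.IsTranslationInvariant)
    (hρ₁ : 0 < ω₁.density) (hρ₁' : ω₁.density < 2) (hρ₂ : 0 < ω₂.density) (hρ₂' : ω₂.density < 2)
    {lam : ℝ} (hl0 : 0 ≤ lam) (hl1 : lam < 1)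
    (hGS : (InfVolFermionState.mix lam hl0 hl1.le ω₁ ω₂).meanEnergy (hubbardTTPrimeFermionInteraction t t' U) 1 ≤
      energyDensityTT' t t' U (InfVolFermionState.mix lam hl0 hl1.le ω₁ ω₂).density) :
    ω₂.meanEnergy (hubbardTTPrimeFermionInteraction t t' U) 1 = energyDensityTT' t t' U ω₂.density := by
  have hv₁ := h₁.energyDensityTT'_le_meanEnergy t t' hU hρ₁ hρ₁'
  have hv₂ := h₂.energyDensityTT'_le_meanEnergy t t' hU hρ₂ hρ₂'
  have hconv := (convexOn_energyDensityTT' t t' hU).2 (x := ω₁.density) (y := ω₂.density) ⟨hρ₁.le, hρ₁'⟩ ⟨hρ₂.le, hρ₂'⟩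
    hl0 (by linarith : 0 ≤ 1 - lam) (by ring)
  simp only [smul_eq_mul] at hconv
  rw [density_mix, meanEnergy_mix] at hGS
  refine le_antisymm ?_ hv₂
  have h1 := mul_le_mul_of_nonneg_left hv₁ hl0
  by_contra hlt
  have hlt' := lt_of_not_ge hlt
  have h2 : (1 - lam) * energyDensityTT' t t' U ω₂.density <
      (1 - lam) * ω₂.meanEnergy (hubbardTTPrimeFermionInteraction t t' U) 1 :=
    mul_lt_mul_of_pos_left hlt' (by linarith)
  linarith

/-- **Coexistence makes `e` affine on the whole segment `[n₁, n₂]`** (`0 < λ < 1`): for all `p, q ≥ 0`, `p + q = 1`,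
`e(p n₁ + q n₂) = p e(n₁) + q e(n₂)`. [cite: Israel1979, Thm. I.2.4] [cite: EmeryKivelsonLin1990, pp. 475–476] -/
theorem IsTranslationInvariant.energyDensityTT'_eq_chord_on_segment_of_mix (t t' : ℝ) (hU : 0 ≤ U)
    {ω₁ ω₂ : InfVolFermionState 2} (h₁ : ω₁.IsTranslationInvariant) (h₂ : ω₂.IsTranslationInvariant)
    (hρ₁ : 0 < ω₁.density) (hρ₁' : ω₁.density < 2) (hρ₂ : 0 < ω₂.density) (hρ₂' : ω₂.density < 2)
    {lam : ℝ} (hl0 : 0 < lam) (hl1 : lam < 1)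
    (hGS : (InfVolFermionState.mix lam hl0.le hl1.le ω₁ ω₂).meanEnergy (hubbardTTPrimeFermionInteraction t t' U) 1 ≤
      energyDensityTT' t t' U (InfVolFermionState.mix lam hl0.le hl1.le ω₁ ω₂).density)
    {p q : ℝ} (hp : 0 ≤ p) (hq : 0 ≤ q) (hpq : p + q = 1) :
    energyDensityTT' t t' U (p * ω₁.density + q * ω₂.density) =
      p * energyDensityTT' t t' U ω₁.density + q * energyDensityTT' t t' U ω₂.density := by
  have heq := h₁.energyDensityTT'_eq_convexComb_of_mix_of_meanEnergy_le t t' hU h₂ hρ₁ hρ₁' hρ₂ hρ₂' hl0.le hl1.le hGS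
  exact convexOn_affine_of_eq_convexComb (convexOn_energyDensityTT' t t' hU) ⟨hρ₁.le, hρ₁'⟩ ⟨hρ₂.le, hρ₂'⟩ hl0
    (by linarith) (by ring) heq hp hq hpq

/-! ### §3 Exclusion readings -/

/-- **Strict convexity at the mean density excludes coexistence.** If `e(λn₁ + (1−λ)n₂) < λe(n₁) + (1−λ)e(n₂)` then the mixture
`λω₁ + (1−λ)ω₂` of ANY translation-invariant states of densities `n₁, n₂ ∈ (0,2)` is NOT a ground state: its mean energy exceeds
`e` at its density. [cite: EmeryKivelsonLin1990, pp. 475–476] [cite: Israel1979, Thm. I.2.4] -/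
theorem IsTranslationInvariant.energyDensityTT'_lt_meanEnergy_mix_of_lt_convexComb (t t' : ℝ) (hU : 0 ≤ U)
    {ω₁ ω₂ : InfVolFermionState 2} (h₁ : ω₁.IsTranslationInvariant) (h₂ : ω₂.IsTranslationInvariant)
    (hρ₁ : 0 < ω₁.density) (hρ₁' : ω₁.density < 2) (hρ₂ : 0 < ω₂.density) (hρ₂' : ω₂.density < 2)
    {lam : ℝ} (hl0 : 0 ≤ lam) (hl1 : lam ≤ 1)
    (hstrict : energyDensityTT' t t' U (lam * ω₁.density + (1 - lam) * ω₂.density) <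
      lam * energyDensityTT' t t' U ω₁.density + (1 - lam) * energyDensityTT' t t' U ω₂.density) :
    energyDensityTT' t t' U (InfVolFermionState.mix lam hl0 hl1 ω₁ ω₂).density <
      (InfVolFermionState.mix lam hl0 hl1 ω₁ ω₂).meanEnergy (hubbardTTPrimeFermionInteraction t t' U) 1 := by
  by_contra hle
  have hle' := le_of_not_gt hle
  have heq := h₁.energyDensityTT'_eq_convexComb_of_mix_of_meanEnergy_le t t' hU h₂ hρ₁ hρ₁' hρ₂ hρ₂' hl0 hl1 hle'
  linarith

/-- **Certified exclusion of phase coexistence from energy windows.** A certified CAP `e(n) ≤ c` at the mean density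
`n = λn₁ + (1−λ)n₂` and certified FLOORS `f₁ ≤ e(n₁)`, `f₂ ≤ e(n₂)` with `c < λf₁ + (1−λ)f₂` imply: no mixture `λω₁ + (1−λ)ω₂` of
translation-invariant states of densities `n₁, n₂` is a ground state (it has mean energy `> e(n)`). [cite: EmeryKivelsonLin1990, pp. 475–476] -/
theorem IsTranslationInvariant.energyDensityTT'_lt_meanEnergy_mix_of_cap_lt_floors (t t' : ℝ) (hU : 0 ≤ U)
    {ω₁ ω₂ : InfVolFermionState 2} (h₁ : ω₁.IsTranslationInvariant) (h₂ : ω₂.IsTranslationInvariant)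
    (hρ₁ : 0 < ω₁.density) (hρ₁' : ω₁.density < 2) (hρ₂ : 0 < ω₂.density) (hρ₂' : ω₂.density < 2)
    {lam : ℝ} (hl0 : 0 ≤ lam) (hl1 : lam ≤ 1) {c f₁ f₂ : ℝ}
    (hcap : energyDensityTT' t t' U (lam * ω₁.density + (1 - lam) * ω₂.density) ≤ c)
    (hf₁ : f₁ ≤ energyDensityTT' t t' U ω₁.density) (hf₂ : f₂ ≤ energyDensityTT' t t' U ω₂.density)
    (hc : c < lam * f₁ + (1 - lam) * f₂) :
    energyDensityTT' t t' U (InfVolFermionState.mix lam hl0 hl1 ω₁ ω₂).density <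
      (InfVolFermionState.mix lam hl0 hl1 ω₁ ω₂).meanEnergy (hubbardTTPrimeFermionInteraction t t' U) 1 := by
  refine h₁.energyDensityTT'_lt_meanEnergy_mix_of_lt_convexComb t t' hU h₂ hρ₁ hρ₁' hρ₂ hρ₂' hl0 hl1 ?_
  have k1 := mul_le_mul_of_nonneg_left hf₁ hl0
  have k2 := mul_le_mul_of_nonneg_left hf₂ (by linarith : 0 ≤ 1 - lam)
  linarith

/-- **One strict-convexity defect excludes a whole family of coexistences.** If at some interior point `n₀ = a n₁ + b n₂`
(`a, b > 0`, `a + b = 1`) `e(n₀) < a e(n₁) + b e(n₂)`, then `e` is NOT affine on `[n₁, n₂]`; hence for every pair of translation-invariant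
states with densities EXACTLY `n₁, n₂` and every weight `0 < λ < 1`, the mixture is not a ground state. (Pairs `n₁' ≤ n₁ < n₂ ≤ n₂'`
are excluded too, by applying this to the affine piece `[n₁', n₂'] ⊇ [n₁, n₂]` — `energyDensityTT'_eq_chord_on_segment_of_mix` — and Jensen on
the sub-chord; stated here for the pair `n₁, n₂`.) [cite: Israel1979, Thm. I.2.4] [cite: EmeryKivelsonLin1990, pp. 475–476] -/
theorem IsTranslationInvariant.energyDensityTT'_lt_meanEnergy_mix_of_strict_at (t t' : ℝ) (hU : 0 ≤ U)
    {ω₁ ω₂ : InfVolFermionState 2} (h₁ : ω₁.IsTranslationInvariant) (h₂ : ω₂.IsTranslationInvariant)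
    (hρ₁ : 0 < ω₁.density) (hρ₁' : ω₁.density < 2) (hρ₂ : 0 < ω₂.density) (hρ₂' : ω₂.density < 2)
    {a b : ℝ} (ha : 0 ≤ a) (hb : 0 ≤ b) (hab : a + b = 1)
    (hstrict : energyDensityTT' t t' U (a * ω₁.density + b * ω₂.density) <
      a * energyDensityTT' t t' U ω₁.density + b * energyDensityTT' t t' U ω₂.density)
    {lam : ℝ} (hl0 : 0 < lam) (hl1 : lam < 1) :
    energyDensityTT' t t' U (InfVolFermionState.mix lam hl0.le hl1.le ω₁ ω₂).density <
      (InfVolFermionState.mix lam hl0.le hl1.le ω₁ ω₂).meanEnergy (hubbardTTPrimeFermionInteraction t t' U) 1 := by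
  by_contra hle
  have hle' := le_of_not_gt hle
  have haff := h₁.energyDensityTT'_eq_chord_on_segment_of_mix t t' hU h₂ hρ₁ hρ₁' hρ₂ hρ₂' hl0 hl1 hle' ha hb hab
  linarith

end InfVolFermionState

/-! ### §4 Super-segment form and the energy gap of a phase-separated state

One certified defect at `(n₁, n₀, n₂)` excludes coexistence of EVERY pair of densities `ρ₁ ≤ n₁ < n₂ ≤ ρ₂`: an affine piece
`[ρ₁, ρ₂]` of `e` would contain `[n₁, n₂]` and force equality in Jensen at `n₀` (`affine_subchord_of_eq_chord`, real analysis).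
Quantitative reading: certified floors at the component densities bound the mixture's mean energy from below
(`meanEnergy_mix` + the variational principle), so a certified cap at the mean density gives the ENERGY GAP of the
phase-separated state above the ground-state energy density. -/

/-- Real analysis: if `f` agrees with its chord on `[x, y]` (`x < y`; `f (p x + q y) = p f x + q f y` for all convex weights
`p, q`), then `f` agrees with every SUB-chord: for `u, v ∈ [x, y]` and convex weights `a, b`, `f (a u + b v) = a f u + b f v`.
[cite: Israel1979, Thm. I.2.4] -/
theorem affine_subchord_of_eq_chord {f : ℝ → ℝ} {x y : ℝ} (hxy : x < y)
    (haff : ∀ {p q : ℝ}, 0 ≤ p → 0 ≤ q → p + q = 1 → f (p * x + q * y) = p * f x + q * f y)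
    {u v : ℝ} (hxu : x ≤ u) (huy : u ≤ y) (hxv : x ≤ v) (hvy : v ≤ y)
    {a b : ℝ} (ha : 0 ≤ a) (hb : 0 ≤ b) (hab : a + b = 1) :
    f (a * u + b * v) = a * f u + b * f v := by
  have hd : 0 < y - x := by linarith
  have hne : y - x ≠ 0 := hd.ne'
  -- every `z ∈ [x, y]` is the convex combination `((y - z)/(y - x)) x + ((z - x)/(y - x)) y`
  have rep : ∀ z, x ≤ z → z ≤ y → f z = (y - z) / (y - x) * f x + (z - x) / (y - x) * f y := by
    intro z hz1 hz2
    have hp : 0 ≤ (y - z) / (y - x) := div_nonneg (by linarith) hd.le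
    have hq : 0 ≤ (z - x) / (y - x) := div_nonneg (by linarith) hd.le
    have hpq : (y - z) / (y - x) + (z - x) / (y - x) = 1 := by
      rw [← add_div, show y - z + (z - x) = y - x by ring, div_self hne]
    have hz : (y - z) / (y - x) * x + (z - x) / (y - x) * y = z := by
      field_simp
      ring
    have h := haff hp hq hpq
    rwa [hz] at h
  have hx' : a * x + b * x = x := by rw [← add_mul, hab, one_mul]
  have hy' : a * y + b * y = y := by rw [← add_mul, hab, one_mul]
  have hw1 : x ≤ a * u + b * v := by
    nlinarith [mul_nonneg ha (sub_nonneg.mpr hxu), mul_nonneg hb (sub_nonneg.mpr hxv), hx']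
  have hw2 : a * u + b * v ≤ y := by
    nlinarith [mul_nonneg ha (sub_nonneg.mpr huy), mul_nonneg hb (sub_nonneg.mpr hvy), hy']
  rw [rep (a * u + b * v) hw1 hw2, rep u hxu huy, rep v hxv hvy]
  have hb' : b = 1 - a := by linarith
  subst hb'
  field_simp
  ring

namespace InfVolFermionState

variable {U : ℝ}

/-- **Super-segment exclusion.** One strict-convexity defect `e(a n₁ + b n₂) < a e(n₁) + b e(n₂)` (`a, b ≥ 0`, `a + b = 1`,
`n₁ < n₂`) excludes macroscopic coexistence of EVERY pair of translation-invariant states with densities `ρ(ω₁) ≤ n₁` and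
`n₂ ≤ ρ(ω₂)` (`0 < ρ(ω₁)`, `ρ(ω₂) < 2`): for every `0 < λ < 1` the mixture `λω₁ + (1−λ)ω₂` has mean energy STRICTLY above
`e` at its density — it is not a ground state (if it were, `e` would be affine on `[ρ(ω₁), ρ(ω₂)] ⊇ [n₁, n₂]`,
`energyDensityTT'_eq_chord_on_segment_of_mix` + `affine_subchord_of_eq_chord`, contradicting the defect).
[cite: Israel1979, Thm. I.2.4] [cite: EmeryKivelsonLin1990, pp. 475–476] -/
theorem IsTranslationInvariant.energyDensityTT'_lt_meanEnergy_mix_of_strict_at_of_le (t t' : ℝ) (hU : 0 ≤ U)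
    {ω₁ ω₂ : InfVolFermionState 2} (h₁ : ω₁.IsTranslationInvariant) (h₂ : ω₂.IsTranslationInvariant)
    (hρ₁ : 0 < ω₁.density) (hρ₂' : ω₂.density < 2)
    {n₁ n₂ : ℝ} (hn₁ : ω₁.density ≤ n₁) (hn : n₁ < n₂) (hn₂ : n₂ ≤ ω₂.density)
    {a b : ℝ} (ha : 0 ≤ a) (hb : 0 ≤ b) (hab : a + b = 1)
    (hstrict : energyDensityTT' t t' U (a * n₁ + b * n₂) <
      a * energyDensityTT' t t' U n₁ + b * energyDensityTT' t t' U n₂)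
    {lam : ℝ} (hl0 : 0 < lam) (hl1 : lam < 1) :
    energyDensityTT' t t' U (InfVolFermionState.mix lam hl0.le hl1.le ω₁ ω₂).density <
      (InfVolFermionState.mix lam hl0.le hl1.le ω₁ ω₂).meanEnergy (hubbardTTPrimeFermionInteraction t t' U) 1 := by
  by_contra hle
  have hle' := le_of_not_gt hle
  have hρ₁' : ω₁.density < 2 := by linarith
  have hρ₂ : 0 < ω₂.density := by linarith
  have haff : ∀ {p q : ℝ}, 0 ≤ p → 0 ≤ q → p + q = 1 →
      energyDensityTT' t t' U (p * ω₁.density + q * ω₂.density) =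
        p * energyDensityTT' t t' U ω₁.density + q * energyDensityTT' t t' U ω₂.density :=
    fun hp hq hpq =>
      h₁.energyDensityTT'_eq_chord_on_segment_of_mix t t' hU h₂ hρ₁ hρ₁' hρ₂ hρ₂' hl0 hl1 hle' hp hq hpq
  have heq := affine_subchord_of_eq_chord (f := energyDensityTT' t t' U) (by linarith) haff
    hn₁ (by linarith) (by linarith) hn₂ ha hb hab
  exact absurd heq (ne_of_lt hstrict)

/-- **Certified super-segment exclusion from energy windows.** A certified CAP `e(a n₁ + b n₂) ≤ c` and certified FLOORS
`f₁ ≤ e(n₁)`, `f₂ ≤ e(n₂)` with POSITIVE EXCLUSION MARGIN `c < a f₁ + b f₂` (`a, b ≥ 0`, `a + b = 1`, `n₁ < n₂`) imply: no mixture of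
translation-invariant states with densities `ρ(ω₁) ≤ n₁` and `n₂ ≤ ρ(ω₂)` (`0 < ρ(ω₁)`, `ρ(ω₂) < 2`) is a ground state at ANY mean
density — macroscopic phase separation into a phase of density `≤ n₁` and a phase of density `≥ n₂` is excluded.
[cite: EmeryKivelsonLin1990, pp. 475–476] [cite: Israel1979, Thm. I.2.4] -/
theorem IsTranslationInvariant.energyDensityTT'_lt_meanEnergy_mix_of_cap_lt_floors_of_le (t t' : ℝ) (hU : 0 ≤ U)
    {ω₁ ω₂ : InfVolFermionState 2} (h₁ : ω₁.IsTranslationInvariant) (h₂ : ω₂.IsTranslationInvariant)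
    (hρ₁ : 0 < ω₁.density) (hρ₂' : ω₂.density < 2)
    {n₁ n₂ : ℝ} (hn₁ : ω₁.density ≤ n₁) (hn : n₁ < n₂) (hn₂ : n₂ ≤ ω₂.density)
    {a b : ℝ} (ha : 0 ≤ a) (hb : 0 ≤ b) (hab : a + b = 1) {c f₁ f₂ : ℝ}
    (hcap : energyDensityTT' t t' U (a * n₁ + b * n₂) ≤ c)
    (hf₁ : f₁ ≤ energyDensityTT' t t' U n₁) (hf₂ : f₂ ≤ energyDensityTT' t t' U n₂)
    (hc : c < a * f₁ + b * f₂)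
    {lam : ℝ} (hl0 : 0 < lam) (hl1 : lam < 1) :
    energyDensityTT' t t' U (InfVolFermionState.mix lam hl0.le hl1.le ω₁ ω₂).density <
      (InfVolFermionState.mix lam hl0.le hl1.le ω₁ ω₂).meanEnergy (hubbardTTPrimeFermionInteraction t t' U) 1 := by
  refine h₁.energyDensityTT'_lt_meanEnergy_mix_of_strict_at_of_le t t' hU h₂ hρ₁ hρ₂' hn₁ hn hn₂ ha hb hab ?_ hl0 hl1
  have k1 := mul_le_mul_of_nonneg_left hf₁ ha
  have k2 := mul_le_mul_of_nonneg_left hf₂ hb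
  linarith

/-- **Mean energy of a mixture from certified floors.** For translation-invariant `ω₁, ω₂` with densities in `(0,2)` and
certified floors `f_i ≤ e(ρ(ω_i))`, every mixture `λω₁ + (1−λ)ω₂` (`0 ≤ λ ≤ 1`) has mean energy `≥ λ f₁ + (1−λ) f₂`
(`e_Φ` is affine, `meanEnergy_mix`; each component obeys the variational principle `e(ρ(ω_i)) ≤ e_Φ(ω_i)`). [folklore]
[cite: Israel1979, Thm. I.2.4] -/
theorem IsTranslationInvariant.convexComb_floors_le_meanEnergy_mix (t t' : ℝ) (hU : 0 ≤ U)
    {ω₁ ω₂ : InfVolFermionState 2} (h₁ : ω₁.IsTranslationInvariant) (h₂ : ω₂.IsTranslationInvariant)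
    (hρ₁ : 0 < ω₁.density) (hρ₁' : ω₁.density < 2) (hρ₂ : 0 < ω₂.density) (hρ₂' : ω₂.density < 2)
    {f₁ f₂ : ℝ} (hf₁ : f₁ ≤ energyDensityTT' t t' U ω₁.density) (hf₂ : f₂ ≤ energyDensityTT' t t' U ω₂.density)
    {lam : ℝ} (hl0 : 0 ≤ lam) (hl1 : lam ≤ 1) :
    lam * f₁ + (1 - lam) * f₂ ≤
      (InfVolFermionState.mix lam hl0 hl1 ω₁ ω₂).meanEnergy (hubbardTTPrimeFermionInteraction t t' U) 1 := by
  have hv₁ := h₁.energyDensityTT'_le_meanEnergy t t' hU hρ₁ hρ₁'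
  have hv₂ := h₂.energyDensityTT'_le_meanEnergy t t' hU hρ₂ hρ₂'
  rw [meanEnergy_mix]
  have k1 := mul_le_mul_of_nonneg_left (hf₁.trans hv₁) hl0
  have k2 := mul_le_mul_of_nonneg_left (hf₂.trans hv₂) (by linarith : 0 ≤ 1 - lam)
  linarith

/-- **Energy gap of the phase-separated state.** With, in addition, a certified CAP `e(λρ(ω₁) + (1−λ)ρ(ω₂)) ≤ c` at the
mixture's density: `e(ρ(mixture)) + (λ f₁ + (1−λ) f₂ − c) ≤ e_Φ(mixture)` — the mixture lies at least the EXCLUSION MARGIN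
`λf₁ + (1−λ)f₂ − c` (per site, in units of `t`) above the ground-state energy density at its own density.
[cite: EmeryKivelsonLin1990, pp. 475–476] -/
theorem IsTranslationInvariant.energyDensityTT'_add_margin_le_meanEnergy_mix (t t' : ℝ) (hU : 0 ≤ U)
    {ω₁ ω₂ : InfVolFermionState 2} (h₁ : ω₁.IsTranslationInvariant) (h₂ : ω₂.IsTranslationInvariant)
    (hρ₁ : 0 < ω₁.density) (hρ₁' : ω₁.density < 2) (hρ₂ : 0 < ω₂.density) (hρ₂' : ω₂.density < 2)
    {c f₁ f₂ : ℝ} (hf₁ : f₁ ≤ energyDensityTT' t t' U ω₁.density) (hf₂ : f₂ ≤ energyDensityTT' t t' U ω₂.density)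
    {lam : ℝ} (hl0 : 0 ≤ lam) (hl1 : lam ≤ 1)
    (hcap : energyDensityTT' t t' U (lam * ω₁.density + (1 - lam) * ω₂.density) ≤ c) :
    energyDensityTT' t t' U (InfVolFermionState.mix lam hl0 hl1 ω₁ ω₂).density + (lam * f₁ + (1 - lam) * f₂ - c) ≤
      (InfVolFermionState.mix lam hl0 hl1 ω₁ ω₂).meanEnergy (hubbardTTPrimeFermionInteraction t t' U) 1 := by
  have h := h₁.convexComb_floors_le_meanEnergy_mix t t' hU h₂ hρ₁ hρ₁' hρ₂ hρ₂' hf₁ hf₂ hl0 hl1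
  rw [density_mix]
  linarith

end InfVolFermionState

end Literature.MathematicalPhysics.QuantumLattice

end
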